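import Summits.QuantumAdvantage.QuantumAdvantage.Theses.ArithStatLadder

/-!
# Route `ArithStatLadder`, item `Assembly` (stmt-QuantumAdvantage-2428)

The assembly item of route `QuantumAdvantage/ArithStatLadder`:
`IqThreeMemBQP → IqThreeNotPPoly → QuantumAdvantage`.

Pure logic over one PROVED tree fact. The summit is the existential form
`QuantumAdvantage := ∃ L, L ∈ BQP ∧ L ∉ BPP`; if no such `L` exists then every BQP language is in
BPP, so IQ3 ∈ BQP ⊆ BPP ⊆ P/poly by Adleman's theorem
(`Literature.Computability.Complexity.BPP_subset_PPoly_holds`, Adleman 1978; Arora–Barak 2009,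
Thm. 7.14 — proved in `Literature/Computability/Complexity/CircuitClassesUniformProofs.lean`),
contradicting `IqThreeNotPPoly` (IQ3 ∉ P/poly). Same shape as `Theorems/CircuitLBAssembly.lean`
and the route's deciding theorem `closes`; nothing number-theoretic is used.
-/

set_option linter.dupNamespace false -- D-0017: single-problem summit ⇒ `QuantumAdvantage.QuantumAdvantage` by design

namespace Summit.QuantumAdvantage.QuantumAdvantage.Theorems.ArithStatLadder

/-- Settles `stmt-QuantumAdvantage-2428` (route ArithStatLadder, assembly): if IQ3 ∈ BQP
(`IqThreeMemBQP`) and IQ3 ∉ P/poly (`IqThreeNotPPoly`) then `QuantumAdvantage`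
(`∃ L ∈ BQP, L ∉ BPP`): otherwise IQ3 ∈ BQP ⊆ BPP ⊆ P/poly by Adleman's theorem `BPP ⊆ P/poly`
(proved tree fact `Literature.Computability.Complexity.BPP_subset_PPoly_holds`), a contradiction.
[cite: Adleman1978] [cite: AroraBarakCC2009, Thm. 7.14] -/
theorem Assembly_proof :
    Summit.QuantumAdvantage.QuantumAdvantage.Theses.ArithStatLadder.Assembly := by
  unfold Summit.QuantumAdvantage.QuantumAdvantage.Theses.ArithStatLadder.Assembly
  intro hBQP hNot
  by_contra h
  exact hNot (Literature.Computability.Complexity.BPP_subset_PPoly_holds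
    (by_contra fun hBPP => h ⟨_, hBQP, hBPP⟩))

end Summit.QuantumAdvantage.QuantumAdvantage.Theorems.ArithStatLadder
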